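import Summits.AtomisticToContinuum.BoseEinsteinCondensation.Theorems.BECInsertionCorrectorStaticResponseBoundTruncationCompactness
import Literature.MathematicalPhysics.QuantumManyBody.PeriodicMaxFormBoundHardCore
import HarnessLib

/-!
# (α') for every admissible potential: stub `stub_truncationEnergyConvergenceAll` (P1) of line
# `third-law-current-floor`, crux `BECConjugateDomination.HardCoreExtension` (stmt-AtomisticToContinuum-11786)

At fixed `(N, L)` with `L > 0` and `E₀(v) < ⊤`, the periodic ground-state energies of the truncations
`min(v, n)` of a repulsive finite-range `v` converge to that of `v`: `E₀(v) ≤ E₀(min(v,n)) + ε` for all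
large `n` (the other inequality is monotonicity). This is the sibling crux's reduction
`truncationLimit_of_maxFormBound` (Rellich compactness of near-minimisers of the truncations through the
free form domain, lower semicontinuity and Beppo Levi) fed with the maximal-form bound for EVERY repulsive
finite-range potential, hard cores and non-integrable singularities included
(`maxFormBound_of_isRepulsiveFiniteRange`, `PeriodicMaxFormBoundHardCore.lean`), and converted from the
`toReal` form to `ℝ≥0∞`. References: B. Simon, J. Operator Theory 1 (1979) 37–47, Thm. 4.1;
[ReedSimonIV1978] Thm. XIII.64.
-/

noncomputable section

namespace Summit.AtomisticToContinuum.BoseEinsteinCondensation.Cruxes.HardCoreExtension.ThirdLawCurrentFloorAlt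

open MeasureTheory Filter
open scoped ENNReal NNReal Topology
open Literature.MathematicalPhysics.QuantumManyBody.BoseGas
open Summit.AtomisticToContinuum.BoseEinsteinCondensation.Cruxes.StaticResponseBound.UvThomsonForceWave

/-- **(α') for every admissible `v`** (registered stub P1 of skeleton v11): for `L > 0` and
`E₀(v) < ⊤`, `E₀(v) ≤ E₀(min(v,n)) + ε` for all large `n`. [cite: ReedSimonIV1978, Thm. XIII.64] -/
theorem stub_truncationEnergyConvergenceAll :
    ∀ v : ℝ → ℝ≥0∞, IsRepulsiveFiniteRange v → ∀ (N : ℕ) (L : ℝ), 0 < L →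
      periodicGroundStateEnergy v N L ≠ ⊤ → ∀ ε : ℝ, 0 < ε → ∃ n₀ : ℕ, ∀ n : ℕ, n₀ ≤ n →
        periodicGroundStateEnergy v N L ≤
          periodicGroundStateEnergy (fun r => min (v r) (n : ℝ≥0∞)) N L + ENNReal.ofReal ε := by
  intro v hv N L hL hE ε hε
  obtain ⟨n₁, hn₁⟩ := truncationLimit_of_maxFormBound maxFormBound_of_isRepulsiveFiniteRange v hv N L hL hE ε hε
  refine ⟨n₁, fun n hn => ?_⟩
  have h := hn₁ n hn
  -- the truncated energy is below `E₀(v)`, hence finite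
  have hle : periodicGroundStateEnergy (truncPotential v n) N L ≤ periodicGroundStateEnergy v N L :=
    periodicGroundStateEnergy_truncPotential_le' v n N L
  have hEn : periodicGroundStateEnergy (truncPotential v n) N L ≠ ⊤ := ne_top_of_le_ne_top hE hle
  have htrunc : (fun r => min (v r) (n : ℝ≥0∞)) = truncPotential v n := rfl
  rw [htrunc, ← ENNReal.ofReal_toReal hE, ← ENNReal.ofReal_toReal hEn, ← ENNReal.ofReal_add ENNReal.toReal_nonneg hε.le]
  exact ENNReal.ofReal_le_ofReal h

end Summit.AtomisticToContinuum.BoseEinsteinCondensation.Cruxes.HardCoreExtension.ThirdLawCurrentFloorAlt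

end
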